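import Summits.BirchSwinnertonDyer.Rank1Residual.X4.KolyvaginIndexRecordsKitOddPrime
import HarnessLib

/-!
# BSD rank-≤1 residual cell, lane class X11b (`p ∥ N`: MULTIPLICATIVE at a prime `p ≥ 5`, `ρ̄_{E,p}` irreducible),
rank ONE: `BSD(E,p)` PER PAIR from
# PUBLISHED theorems + Kolyvagin's HEEGNER-INDEX certificate (two engines), `ρ̄_{E,p}` onto IN THE KERNEL — records 70

HONEST FRAMING (cell `b2b-bsdres-*`, verbatim): prove what is provable now; shrink each hard class to its core with
data; no claim beyond stated classes; COMBINATION classes deleted from PUBLISHED theorems only, CONSTRUCTION-shaped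
remainder typed; this is not "finishing BSD". X11b stays CONSTRUCTION-SHAPED; everything here is PER PAIR; no lane
verdict is changed; no named fact is introduced (debt 0); nothing is booked by this unit (the rung-K2 owner
bsd-stepL, the x11b
lineage that holds row B9's E1/K2 claim, census-lead, the Kurihara lane and referee A decide what a record is
worth); Cremona's numbers
(`r_an = 1`, `#Ш_an`, models, generators, `∏ c_ℓ`, torsion, optimality / Manin codes, the galrep datum) are INPUTS.

Unit `b2b-bsdres-x11c`, GEN 32 (prover-b2b-bsdres-x11c-g32-0) — the «X11 beyond 3» half of the unit's D-0075 purpose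
(«GRH-free
Kolyvagin–Heegner-index certificates X4 r1 p ≥ 7, X11 beyond 3»): the cell's certificate engines turned on lane
class X11b as GEN 27–31 turned
them on X7 (`Supersingular/KolyvaginIndexRecordsX7RankOne01–432`). POPULATION
(`HOME/b2b-bsdres-x11c/gen32/pop/build_harvest_x11b.py` = gen 27's
class-agnostic census restricted to X11b with a per-(label, p) record test): the rank-ONE classes (Cremona curve 1,
non-CM) whose cell
`(p, X11b)` — `p ≥ 5`, `p ∥ N` — is OPEN on the Kurihara lane's residue of record (bsdN sweep v4u `RESIDUE.jsonl` ×
v5u verdict `residue`; on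
848 of them the lane's own tail is T-KOLY, whose single certified Heegner field excludes the primes dividing
`m·D_K`) and which are
certificate-shaped on Cremona's data — no galrep code at `p` (`ρ̄_{E,p}` onto), `p ∤ #E(ℚ)_tors·∏ c_ℓ` (so
`p ∤ c_p = ord_p Δ` at a split
`p`), `p ∤ #Ш_an` — and carry no Kolyvagin-index record `bsdp_k<label>_<p>`: 927 pairs on 869 classes (`p = 5`: 605,
`7`: 221, `11`: 41,
`13`: 20, `17 ≤ p ≤ 103`: 40; split 411 / non-split 516; 268 semistable; `1.6·10⁴ < N < 5·10⁵`). 920 of them ALSO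
carry the unit's GEN 10
beyond-window DATA record (`X11b/BeyondWindowRecordsNN`: Skinner 2016 Thm. A ∘ Stein–Wuthrich 2013 `p`-adic road,
binders as displayed there)
— for those this file is a SECOND, GRH-free and main-conjecture-free road; 7 carry no per-pair record. Not in reach
of this route (numbers, not
a verdict): the lane's 3 062 Tamagawa-obstructed X11b rank-one cells at `p ≥ 5` (`p ∣ c_q` for some `q`; Jetchev
2008's Hypothesis (∗)
`p ∤ N` fails at `p ∥ N`). THIS FILE (records 70): 10 pairs — `310590do1@7`, `311850dg1@7`, `315588g1@7`,
`317688l1@7`, `319200a1@7`, `319200bj1@7`, `322770bt1@7`, `322770c1@7`, `323610a1@7`, `325710bt1@7`. 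

THE ROUTE (the unit's GEN 26/27 Kolyvagin route, class-agnostic): Kolyvagin's theorem as PRINTED by McCallum (LMS LN
153 (1991) §1, p. 296) /
Gross (ibid., Prop. 2.1 (2)) — tree named facts `kolyvagin`, `Kolyvagin1990_padicValNat_card_sha_le`, whose printed
hypotheses are `y_K` of
infinite order, `p` odd, `ρ̄_{E,p}` onto, and NOTHING about the reduction of `E` at `p` (at `p ∥ N` the Heegner
hypothesis — every prime of
`N` split in `K` — makes `p` split in `K`; nothing more is asked) —: `ord_p #Ш(E/K) ≤ 2·ord_p [E(K):ℤy_K]`; so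
`p ∤ [E(K):ℤy_K]` gives
`Ш(E/K)[p] = 0`, hence `Ш(E/ℚ)[p] = 0`, and with `ord_p #Ш_an = 0` Miller's `BSD(E,p)` — the tree's class-agnostic
consumer
`Typed.bsdp_of_kolyvagin_of_not_dvd_index` (`Literature/…/Rank1Residual/Typed/KolyvaginCertificate.lean`).

THE CERTIFICATE (per pair; the cell's EXISTING engines run VERBATIM — no private engine, no knob; ONE batched kit
job per stage with an
in-job fan-out wrapper): engine 1 = gen 3's `engine1_cha1b/main.py` = x9-g7 `jobD1b.py` (cypari2, sha256
`69e29ec7…`; rank-one mode: Heegner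
fields `K = ℚ(√D)`, `D < -4` fundamental, every prime of `N` split, `p ∤ D`, increasing `|D| ≤ 6000`, `≤ 30` fields;
root number of `E^D`
`+1`, rank-`≥ 2` twists skipped; `hy = L'(E,1)·L(E^D,1)·√|D|/(4·Area(E))`, `ρ = hy/ĥ(x)`, `m = √(4ρ)` an integer,
CERT iff `p ∤ m` —
Miller 2011 Thm. 4.1 / Cor. 4.8); engine 2 = gen 3's `engine2/run_cert.py` (`1b54bb20…`) + `e2lib.py` (`6701e05d…`)
+ `tate_stdlib.py`
(`ed9e5fd9…`) (stdlib python: independent `L`-series, AGM periods, Tate heights; `m`, `ord_p m` must be EQUAL;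
discrete checks — model,
conductor, Tamagawa, non-CM, irreducibility / saturation / `E(K)[p] = 0` witnesses, `D` Heegner); twist values =
additive-p1's
`twistvals/main.py` (`e501b988…`). Kit jobs: j259809, j260660, j260662, j260664, j260667. Evidence:
`HOME/b2b-bsdres-x11c/gen32/` (`KOLY-X11BR1-TABLE.md`, outputs, inputs,
SHA256SUMS); REPORT.md §41.

KERNEL (per pair, through the unit's kit theorem `X4.bsdp_prime_of_kolyvaginIndex_of_serreCounts` of
`X4/KolyvaginIndexRecordsKitOddPrime.lean` — class-agnostic despite its namespace —, every numeric hypothesis a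
`decide` goal): `Δ ≠ 0`;
global minimality of Cremona's model (bounded Kraus criterion); `ρ̄_{E,p}` ONTO by Serre's Prop. 19 from three
witness primes
`(ℓ₁, ℓ₂, ℓ₃)` (types s₁ split / s₂ non-split / s₃ `u = a²/ℓ ∉ {0,1,2,4}`, `u² − 3u + 1 ≢ 0`) whose point counts
`#Ẽ(𝔽_ℓ)` (schema
`countPoints`) are evaluated in the kernel. BINDERS (displayed in every theorem): `hGZK` (Gross–Zagier–Kolyvagin),
`hKo` / `hB` (Kolyvagin
as printed), the Heegner datum (`K`, level `N`, `P`, `p ∤ [E(K):ℤP]`), `r_an ≤ 1`, `#Ш_an = q` with `ord_p q = 0`.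
NOT rechecked in the
kernel (engine work): `L'(E,1)`, `L(E^D,1)`, periods, heights, saturation, the integrality of `4ρ`; nor the lane's
class bit (`p ∥ N`,
split / non-split — bookkeeping only, the route does not use it). What a record is worth is the owners' / lane's /
referee's call
(EVIDENCE-grade certificate under displayed binders, as every Heegner-index record of the cell).

References: McCallum 1991 §1 [McCallumLMS1991]; Gross 1991 Prop. 2.1 [GrossLMS1991]; Kolyvagin 1990
[KolyvaginEulerSystems1990]; Serre 1972 §2.8 Prop. 19 [Serre1972]; Miller 2011 Def. 1.1, Thm. 4.1, Cor. 4.8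
[Miller2011LMS];
Silverman AEC VII.1, VIII.8 [SilvermanAEC2009]; Cremona's tables [Cremona2006].
-/

set_option autoImplicit false

noncomputable section

open scoped Classical

open WeierstrassCurve Literature.NumberTheory.EllipticCurves
  Literature.NumberTheory.EllipticCurves.Rank1Residual
  Literature.NumberTheory.EllipticCurves.Rank1Residual.Typed
  Literature.NumberTheory.EllipticCurves.Rank1Residual.X11RankOneCertificates
  Summit.BirchSwinnertonDyer.BirchSwinnertonDyer.Rank1Residual.IntModel
  Summit.BirchSwinnertonDyer.BirchSwinnertonDyer.Rank1Residual.X11RankOne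
  Summit.BirchSwinnertonDyer.Rank1Residual.X4

namespace Summit.BirchSwinnertonDyer.Rank1Residual.X11b

/-- **`BSD(E,7)` for `310590do1`** (`N = 310590 = 2·3²·5·7·17·29`; NON-SPLIT MULTIPLICATIVE at `7` (Kodaira `I7`, `c_7 = 1`, additive at `3`);
`#tors = 1`, `∏c = 2`, `r_an = 1`, `#Ш_an = 1`, generator Cremona's (16-digit numerator); lane residue cell `(7, X11b)` (bsdN v4u/v5u of record:
`residue:X11b`, lane tail T-KOLY); ALSO the unit's GEN 10 beyond-window DATA record in `X11b/BeyondWindowRecords38.lean` (Skinner 2016 Thm. A ∘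
Stein–Wuthrich 2013 `p`-adic road, binders as displayed there) — this row is a SECOND road). `D = -3239` (3239 = 41·79): **`m = [E(K):ℤy_K] = 8`,
`7 ∤ m`** (`ρ = 16.00…`; `L'(E,1) = 13.40533516…`, `L(E^D,1) = 0.01764230…`, `ĥ(x) = 34.24984915…`) — engine 1 (j259809) = engine 2 (j260662; EQUAL,
dev. ≤ 1.8·10⁻¹², checks true); twist `E^D` (j260667): `#tors·∏c·#Ш_an = 1·4·4`, prime to `7` — BSD-consistent. Witnesses mod `7` `(ℓ,#Ẽ(𝔽_ℓ))` =
`(11,14)` (`a = -2`, `a² − 4ℓ ≡ 2` square), `(19,15)` (`a = 5`, `a² − 4ℓ ≡ 5` non-square), `(13,16)` (`u ≡ 3`).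
[cite: McCallumLMS1991, §1 Theorem (Kolyvagin), p. 296] [cite: Serre1972, §2.8 Prop. 19] [cite: Cremona2006, Table 1 (label 310590do1)] -/
theorem bsdp_k310590do1_7 (hGZK : rank_eq_analyticRank_of_analyticRank_le_one) (W : WeierstrassCurve ℚ)
    (hW : W = ⟨1, -1, 1, -2065772, 1199198089⟩) {N : ℕ} [NeZero N] {K : Type} [Field K] [NumberField K]
    (hKo : kolyvagin N W K) (hB : Kolyvagin1990_padicValNat_card_sha_le N W K) (hK : IsImaginaryQuadratic K)
    (hH : SatisfiesHeegnerHypothesis N K) {P : (W.baseChange K).toAffine.Point} (hP : IsHeegnerPoint N W K P)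
    (hnt : ¬ IsOfFinAddOrder P) (hI : ¬ 7 ∣ (AddSubgroup.zmultiples P).index) (hr : W.analyticRank ≤ 1)
    {q : ℚ} (hq : shaAn W = (q : ℂ)) (hv : padicValRat 7 q = 0) : BSDp W 7 :=
  bsdp_prime_of_kolyvaginIndex_of_serreCounts 7 (by norm_num) (by norm_num) 1 (-1) 1 (-2065772) 1199198089 (by decide +kernel)
    (by decide +kernel) (by decide +kernel) 11 19 13 (by norm_num) (by norm_num) (by norm_num) (by norm_num)
    (by norm_num) (by norm_num) (by norm_num) (by norm_num) (by norm_num) (by decide +kernel) (by decide +kernel)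
    (by decide +kernel) (n₁ := 14) (n₂ := 15) (n₃ := 16) (hc₁ := by decide +kernel) (hc₂ := by decide +kernel)
    (hc₃ := by decide +kernel) (by decide +kernel) (by decide +kernel) (by decide +kernel) hGZK W
    (by rw [hW]; norm_num) hKo hB hK hH hP hnt hI hr hq hv

/-- **`BSD(E,7)` for `311850dg1`** (`N = 311850 = 2·3⁴·5²·7·11`; NON-SPLIT MULTIPLICATIVE at `7` (Kodaira `I10`, `c_7 = 2`, additive at `3`, `5`);
`#tors = 1`, `∏c = 60`, `r_an = 1`, `#Ш_an = 1`, generator `(2425, 49208)`; lane residue cell `(7, X11b)` (bsdN v4u/v5u of record: `residue:X11b`,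
lane tail T-KOLY); ALSO the unit's GEN 10 beyond-window DATA record in `X11b/BeyondWindowRecords38.lean` (Skinner 2016 Thm. A ∘ Stein–Wuthrich 2013
`p`-adic road, binders as displayed there) — this row is a SECOND road). `D = -1559` (1559 prime): **`m = [E(K):ℤy_K] = 120`, `7 ∤ m`**
(`ρ = 3600.00…`; `L'(E,1) = 12.72241364…`, `L(E^D,1) = 0.10105530…`, `ĥ(x) = 1.10631390…`) — engine 1 (j259809) = engine 2 (j260662; EQUAL, dev. ≤
2.2·10⁻¹³, checks true); twist `E^D` (j260667): `#tors·∏c·#Ш_an = 1·120·1`, prime to `7` — BSD-consistent. Witnesses mod `7` `(ℓ,#Ẽ(𝔽_ℓ))` =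
`(13,12)` (`a = 2`, `a² − 4ℓ ≡ 1` square), `(17,16)` (`a = 2`, `a² − 4ℓ ≡ 6` non-square), `(13,12)` (`u ≡ 3`).
[cite: McCallumLMS1991, §1 Theorem (Kolyvagin), p. 296] [cite: Serre1972, §2.8 Prop. 19] [cite: Cremona2006, Table 1 (label 311850dg1)] -/
theorem bsdp_k311850dg1_7 (hGZK : rank_eq_analyticRank_of_analyticRank_le_one) (W : WeierstrassCurve ℚ)
    (hW : W = ⟨1, -1, 1, -26562755, 52700851747⟩) {N : ℕ} [NeZero N] {K : Type} [Field K] [NumberField K]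
    (hKo : kolyvagin N W K) (hB : Kolyvagin1990_padicValNat_card_sha_le N W K) (hK : IsImaginaryQuadratic K)
    (hH : SatisfiesHeegnerHypothesis N K) {P : (W.baseChange K).toAffine.Point} (hP : IsHeegnerPoint N W K P)
    (hnt : ¬ IsOfFinAddOrder P) (hI : ¬ 7 ∣ (AddSubgroup.zmultiples P).index) (hr : W.analyticRank ≤ 1)
    {q : ℚ} (hq : shaAn W = (q : ℂ)) (hv : padicValRat 7 q = 0) : BSDp W 7 :=
  bsdp_prime_of_kolyvaginIndex_of_serreCounts 7 (by norm_num) (by norm_num) 1 (-1) 1 (-26562755) 52700851747 (by decide +kernel)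
    (by decide +kernel) (by decide +kernel) 13 17 13 (by norm_num) (by norm_num) (by norm_num) (by norm_num)
    (by norm_num) (by norm_num) (by norm_num) (by norm_num) (by norm_num) (by decide +kernel) (by decide +kernel)
    (by decide +kernel) (n₁ := 12) (n₂ := 16) (n₃ := 12) (hc₁ := by decide +kernel) (hc₂ := by decide +kernel)
    (hc₃ := by decide +kernel) (by decide +kernel) (by decide +kernel) (by decide +kernel) hGZK W
    (by rw [hW]; norm_num) hKo hB hK hH hP hnt hI hr hq hv

/-- **`BSD(E,7)` for `315588g1`** (`N = 315588 = 2²·3·7·13·17²`; SPLIT MULTIPLICATIVE at `7` (Kodaira `I2`, `c_7 = 2`, additive at `2`, `17`);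
`#tors = 1`, `∏c = 6`, `r_an = 1`, `#Ш_an = 1`, generator `(83824, 24255951)`; lane residue cell `(7, X11b)` (bsdN v4u/v5u of record:
`residue:X11b`, lane tail T-KOLY); ALSO the unit's GEN 10 beyond-window DATA record in `X11b/BeyondWindowRecords39.lean` (Skinner 2016 Thm. A ∘
Stein–Wuthrich 2013 `p`-adic road, binders as displayed there) — this row is a SECOND road). `D = -1511` (1511 prime): **`m = [E(K):ℤy_K] = 72`,
`7 ∤ m`** (`ρ = 1295.99…`; `L'(E,1) = 2.99049805…`, `L(E^D,1) = 1.98995862…`, `ĥ(x) = 10.89294765…`) — engine 1 (j259809) = engine 2 (j260664;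
EQUAL, dev. ≤ 2.8·10⁻¹⁴, checks true); twist `E^D` (j260667): `#tors·∏c·#Ш_an = 1·12·36`, prime to `7` — BSD-consistent. Witnesses mod `7`
`(ℓ,#Ẽ(𝔽_ℓ))` = `(5,7)` (`a = -1`, `a² − 4ℓ ≡ 2` square), `(31,30)` (`a = 2`, `a² − 4ℓ ≡ 6` non-square), `(5,7)` (`u ≡ 3`).
[cite: McCallumLMS1991, §1 Theorem (Kolyvagin), p. 296] [cite: Serre1972, §2.8 Prop. 19] [cite: Cremona2006, Table 1 (label 315588g1)] -/
theorem bsdp_k315588g1_7 (hGZK : rank_eq_analyticRank_of_analyticRank_le_one) (W : WeierstrassCurve ℚ)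
    (hW : W = ⟨0, -1, 0, -7399686, -7775843583⟩) {N : ℕ} [NeZero N] {K : Type} [Field K] [NumberField K]
    (hKo : kolyvagin N W K) (hB : Kolyvagin1990_padicValNat_card_sha_le N W K) (hK : IsImaginaryQuadratic K)
    (hH : SatisfiesHeegnerHypothesis N K) {P : (W.baseChange K).toAffine.Point} (hP : IsHeegnerPoint N W K P)
    (hnt : ¬ IsOfFinAddOrder P) (hI : ¬ 7 ∣ (AddSubgroup.zmultiples P).index) (hr : W.analyticRank ≤ 1)
    {q : ℚ} (hq : shaAn W = (q : ℂ)) (hv : padicValRat 7 q = 0) : BSDp W 7 :=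
  bsdp_prime_of_kolyvaginIndex_of_serreCounts 7 (by norm_num) (by norm_num) 0 (-1) 0 (-7399686) (-7775843583) (by decide +kernel)
    (by decide +kernel) (by decide +kernel) 5 31 5 (by norm_num) (by norm_num) (by norm_num) (by norm_num)
    (by norm_num) (by norm_num) (by norm_num) (by norm_num) (by norm_num) (by decide +kernel) (by decide +kernel)
    (by decide +kernel) (n₁ := 7) (n₂ := 30) (n₃ := 7) (hc₁ := by decide +kernel) (hc₂ := by decide +kernel)
    (hc₃ := by decide +kernel) (by decide +kernel) (by decide +kernel) (by decide +kernel) hGZK W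
    (by rw [hW]; norm_num) hKo hB hK hH hP hnt hI hr hq hv

/-- **`BSD(E,7)` for `317688l1`** (`N = 317688 = 2³·3·7·31·61`; SPLIT MULTIPLICATIVE at `7` (Kodaira `I3`, `c_7 = 3`, additive at `2`); `#tors = 1`,
`∏c = 3`, `r_an = 1`, `#Ш_an = 1`, generator `(13/9, 17360/27)`; lane residue cell `(7, X11b)` (bsdN v4u/v5u of record: `residue:X11b,X7`, lane tail
T-KOLY, other open cells `(167, X7)`); ALSO the unit's GEN 10 beyond-window DATA record in `X11b/BeyondWindowRecords39.lean` (Skinner 2016 Thm. A ∘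
Stein–Wuthrich 2013 `p`-adic road, binders as displayed there) — this row is a SECOND road). `D = -2399` (2399 prime): **`m = [E(K):ℤy_K] = 78`,
`7 ∤ m`** (`ρ = 1520.99…`; `L'(E,1) = 10.63629880…`, `L(E^D,1) = 4.95761294…`, `ĥ(x) = 5.59203750…`) — engine 1 (j259809) = engine 2 (j260664;
EQUAL, dev. ≤ 6.5·10⁻¹⁴, checks true); twist `E^D` (j260667): `#tors·∏c·#Ш_an = 1·6·169`, prime to `7` — BSD-consistent. Witnesses mod `7`
`(ℓ,#Ẽ(𝔽_ℓ))` = `(11,7)` (`a = 5`, `a² − 4ℓ ≡ 2` square), `(5,2)` (`a = 4`, `a² − 4ℓ ≡ 3` non-square), `(5,2)` (`u ≡ 6`).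
[cite: McCallumLMS1991, §1 Theorem (Kolyvagin), p. 296] [cite: Serre1972, §2.8 Prop. 19] [cite: Cremona2006, Table 1 (label 317688l1)] -/
theorem bsdp_k317688l1_7 (hGZK : rank_eq_analyticRank_of_analyticRank_le_one) (W : WeierstrassCurve ℚ)
    (hW : W = ⟨0, -1, 0, -9296, 426828⟩) {N : ℕ} [NeZero N] {K : Type} [Field K] [NumberField K]
    (hKo : kolyvagin N W K) (hB : Kolyvagin1990_padicValNat_card_sha_le N W K) (hK : IsImaginaryQuadratic K)
    (hH : SatisfiesHeegnerHypothesis N K) {P : (W.baseChange K).toAffine.Point} (hP : IsHeegnerPoint N W K P)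
    (hnt : ¬ IsOfFinAddOrder P) (hI : ¬ 7 ∣ (AddSubgroup.zmultiples P).index) (hr : W.analyticRank ≤ 1)
    {q : ℚ} (hq : shaAn W = (q : ℂ)) (hv : padicValRat 7 q = 0) : BSDp W 7 :=
  bsdp_prime_of_kolyvaginIndex_of_serreCounts 7 (by norm_num) (by norm_num) 0 (-1) 0 (-9296) 426828 (by decide +kernel)
    (by decide +kernel) (by decide +kernel) 11 5 5 (by norm_num) (by norm_num) (by norm_num) (by norm_num)
    (by norm_num) (by norm_num) (by norm_num) (by norm_num) (by norm_num) (by decide +kernel) (by decide +kernel)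
    (by decide +kernel) (n₁ := 7) (n₂ := 2) (n₃ := 2) (hc₁ := by decide +kernel) (hc₂ := by decide +kernel)
    (hc₃ := by decide +kernel) (by decide +kernel) (by decide +kernel) (by decide +kernel) hGZK W
    (by rw [hW]; norm_num) hKo hB hK hH hP hnt hI hr hq hv

/-- **`BSD(E,7)` for `319200a1`** (`N = 319200 = 2⁵·3·5²·7·19`; NON-SPLIT MULTIPLICATIVE at `7` (Kodaira `I1`, `c_7 = 1`, additive at `2`, `5`);
`#tors = 1`, `∏c = 12`, `r_an = 1`, `#Ш_an = 1`, generator `(-83, 950)`; lane residue cell `(7, X11b)` (bsdN v4u/v5u of record: `residue:X11b`, lane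
tail T-KOLY); ALSO the unit's GEN 10 beyond-window DATA record in `X11b/BeyondWindowRecords39.lean` (Skinner 2016 Thm. A ∘ Stein–Wuthrich 2013
`p`-adic road, binders as displayed there) — this row is a SECOND road). `D = -1511` (1511 prime): **`m = [E(K):ℤy_K] = 72`, `7 ∤ m`**
(`ρ = 1296.00…`; `L'(E,1) = 4.40852385…`, `L(E^D,1) = 1.27037949…`, `ĥ(x) = 0.85670455…`) — engine 1 (j259809) = engine 2 (j260664; EQUAL, dev. ≤
1.7·10⁻¹⁴, checks true); twist `E^D` (j260667): `#tors·∏c·#Ш_an = 1·24·9`, prime to `7` — BSD-consistent. Witnesses mod `7` `(ℓ,#Ẽ(𝔽_ℓ))` =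
`(17,21)` (`a = -3`, `a² − 4ℓ ≡ 4` square), `(11,18)` (`a = -6`, `a² − 4ℓ ≡ 6` non-square), `(13,13)` (`u ≡ 6`).
[cite: McCallumLMS1991, §1 Theorem (Kolyvagin), p. 296] [cite: Serre1972, §2.8 Prop. 19] [cite: Cremona2006, Table 1 (label 319200a1)] -/
theorem bsdp_k319200a1_7 (hGZK : rank_eq_analyticRank_of_analyticRank_le_one) (W : WeierstrassCurve ℚ)
    (hW : W = ⟨0, -1, 0, -4208, 1131912⟩) {N : ℕ} [NeZero N] {K : Type} [Field K] [NumberField K]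
    (hKo : kolyvagin N W K) (hB : Kolyvagin1990_padicValNat_card_sha_le N W K) (hK : IsImaginaryQuadratic K)
    (hH : SatisfiesHeegnerHypothesis N K) {P : (W.baseChange K).toAffine.Point} (hP : IsHeegnerPoint N W K P)
    (hnt : ¬ IsOfFinAddOrder P) (hI : ¬ 7 ∣ (AddSubgroup.zmultiples P).index) (hr : W.analyticRank ≤ 1)
    {q : ℚ} (hq : shaAn W = (q : ℂ)) (hv : padicValRat 7 q = 0) : BSDp W 7 :=
  bsdp_prime_of_kolyvaginIndex_of_serreCounts 7 (by norm_num) (by norm_num) 0 (-1) 0 (-4208) 1131912 (by decide +kernel)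
    (by decide +kernel) (by decide +kernel) 17 11 13 (by norm_num) (by norm_num) (by norm_num) (by norm_num)
    (by norm_num) (by norm_num) (by norm_num) (by norm_num) (by norm_num) (by decide +kernel) (by decide +kernel)
    (by decide +kernel) (n₁ := 21) (n₂ := 18) (n₃ := 13) (hc₁ := by decide +kernel) (hc₂ := by decide +kernel)
    (hc₃ := by decide +kernel) (by decide +kernel) (by decide +kernel) (by decide +kernel) hGZK W
    (by rw [hW]; norm_num) hKo hB hK hH hP hnt hI hr hq hv

/-- **`BSD(E,7)` for `319200bj1`** (`N = 319200 = 2⁵·3·5²·7·19`; NON-SPLIT MULTIPLICATIVE at `7` (Kodaira `I1`, `c_7 = 1`, additive at `2`, `5`);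
`#tors = 1`, `∏c = 4`, `r_an = 1`, `#Ш_an = 1`, generator `(-23, 900)`; lane residue cell `(7, X11b)` (bsdN v4u/v5u of record: `residue:X11b`, lane
tail T-KOLY); ALSO the unit's GEN 10 beyond-window DATA record in `X11b/BeyondWindowRecords39.lean` (Skinner 2016 Thm. A ∘ Stein–Wuthrich 2013
`p`-adic road, binders as displayed there) — this row is a SECOND road). `D = -1511` (1511 prime): **`m = [E(K):ℤy_K] = 24`, `7 ∤ m`**
(`ρ = 144.00…`; `L'(E,1) = 4.08580928…`, `L(E^D,1) = 0.46000430…`, `ĥ(x) = 2.29571432…`) — engine 1 (j259809) = engine 2 (j260664; EQUAL, dev. ≤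
1.6·10⁻¹⁴, checks true); twist `E^D` (j260667): `#tors·∏c·#Ш_an = 1·8·9`, prime to `7` — BSD-consistent. Witnesses mod `7` `(ℓ,#Ẽ(𝔽_ℓ))` = `(17,21)`
(`a = -3`, `a² − 4ℓ ≡ 4` square), `(37,40)` (`a = -2`, `a² − 4ℓ ≡ 3` non-square), `(17,21)` (`u ≡ 3`).
[cite: McCallumLMS1991, §1 Theorem (Kolyvagin), p. 296] [cite: Serre1972, §2.8 Prop. 19] [cite: Cremona2006, Table 1 (label 319200bj1)] -/
theorem bsdp_k319200bj1_7 (hGZK : rank_eq_analyticRank_of_analyticRank_le_one) (W : WeierstrassCurve ℚ)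
    (hW : W = ⟨0, -1, 0, -1408, 790312⟩) {N : ℕ} [NeZero N] {K : Type} [Field K] [NumberField K]
    (hKo : kolyvagin N W K) (hB : Kolyvagin1990_padicValNat_card_sha_le N W K) (hK : IsImaginaryQuadratic K)
    (hH : SatisfiesHeegnerHypothesis N K) {P : (W.baseChange K).toAffine.Point} (hP : IsHeegnerPoint N W K P)
    (hnt : ¬ IsOfFinAddOrder P) (hI : ¬ 7 ∣ (AddSubgroup.zmultiples P).index) (hr : W.analyticRank ≤ 1)
    {q : ℚ} (hq : shaAn W = (q : ℂ)) (hv : padicValRat 7 q = 0) : BSDp W 7 :=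
  bsdp_prime_of_kolyvaginIndex_of_serreCounts 7 (by norm_num) (by norm_num) 0 (-1) 0 (-1408) 790312 (by decide +kernel)
    (by decide +kernel) (by decide +kernel) 17 37 17 (by norm_num) (by norm_num) (by norm_num) (by norm_num)
    (by norm_num) (by norm_num) (by norm_num) (by norm_num) (by norm_num) (by decide +kernel) (by decide +kernel)
    (by decide +kernel) (n₁ := 21) (n₂ := 40) (n₃ := 21) (hc₁ := by decide +kernel) (hc₂ := by decide +kernel)
    (hc₃ := by decide +kernel) (by decide +kernel) (by decide +kernel) (by decide +kernel) hGZK W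
    (by rw [hW]; norm_num) hKo hB hK hH hP hnt hI hr hq hv

/-- **`BSD(E,7)` for `322770bt1`** (`N = 322770 = 2·3·5·7·29·53`; NON-SPLIT MULTIPLICATIVE at `7` (Kodaira `I11`, `c_7 = 1`, semistable); `#tors = 1`,
`∏c = 2`, `r_an = 1`, `#Ш_an = 1`, generator Cremona's (32-digit numerator); lane residue cell `(7, X11b)` (bsdN v4u/v5u of record: `residue:X11b`,
lane tail T-KOLY); ALSO the unit's GEN 10 beyond-window DATA record in `X11b/BeyondWindowRecords40.lean` (Skinner 2016 Thm. A ∘ Stein–Wuthrich 2013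
`p`-adic road, binders as displayed there) — this row is a SECOND road). `D = -2519` (2519 = 11·229): **`m = [E(K):ℤy_K] = 40`, `7 ∤ m`**
(`ρ = 400.00…`; `L'(E,1) = 10.96629281…`, `L(E^D,1) = 0.80461615…`, `ĥ(x) = 72.97405415…`) — engine 1 (j259809) = engine 2 (j260660; EQUAL, dev. ≤
1.6·10⁻¹⁴, checks true); twist `E^D` (j260667): `#tors·∏c·#Ш_an = 1·4·100`, prime to `7` — BSD-consistent. Witnesses mod `7` `(ℓ,#Ẽ(𝔽_ℓ))` =
`(13,19)` (`a = -5`, `a² − 4ℓ ≡ 1` square), `(11,6)` (`a = 6`, `a² − 4ℓ ≡ 6` non-square), `(13,19)` (`u ≡ 3`).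
[cite: McCallumLMS1991, §1 Theorem (Kolyvagin), p. 296] [cite: Serre1972, §2.8 Prop. 19] [cite: Cremona2006, Table 1 (label 322770bt1)] -/
theorem bsdp_k322770bt1_7 (hGZK : rank_eq_analyticRank_of_analyticRank_le_one) (W : WeierstrassCurve ℚ)
    (hW : W = ⟨1, 1, 1, 2117284, -2048979391⟩) {N : ℕ} [NeZero N] {K : Type} [Field K] [NumberField K]
    (hKo : kolyvagin N W K) (hB : Kolyvagin1990_padicValNat_card_sha_le N W K) (hK : IsImaginaryQuadratic K)
    (hH : SatisfiesHeegnerHypothesis N K) {P : (W.baseChange K).toAffine.Point} (hP : IsHeegnerPoint N W K P)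
    (hnt : ¬ IsOfFinAddOrder P) (hI : ¬ 7 ∣ (AddSubgroup.zmultiples P).index) (hr : W.analyticRank ≤ 1)
    {q : ℚ} (hq : shaAn W = (q : ℂ)) (hv : padicValRat 7 q = 0) : BSDp W 7 :=
  bsdp_prime_of_kolyvaginIndex_of_serreCounts 7 (by norm_num) (by norm_num) 1 1 1 2117284 (-2048979391) (by decide +kernel)
    (by decide +kernel) (by decide +kernel) 13 11 13 (by norm_num) (by norm_num) (by norm_num) (by norm_num)
    (by norm_num) (by norm_num) (by norm_num) (by norm_num) (by norm_num) (by decide +kernel) (by decide +kernel)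
    (by decide +kernel) (n₁ := 19) (n₂ := 6) (n₃ := 19) (hc₁ := by decide +kernel) (hc₂ := by decide +kernel)
    (hc₃ := by decide +kernel) (by decide +kernel) (by decide +kernel) (by decide +kernel) hGZK W
    (by rw [hW]; norm_num) hKo hB hK hH hP hnt hI hr hq hv

/-- **`BSD(E,7)` for `322770c1`** (`N = 322770 = 2·3·5·7·29·53`; NON-SPLIT MULTIPLICATIVE at `7` (Kodaira `I6`, `c_7 = 2`, semistable); `#tors = 1`,
`∏c = 20`, `r_an = 1`, `#Ш_an = 1`, generator `(25983, 157311)`; lane residue cell `(7, X11b)` (bsdN v4u/v5u of record: `residue:X11b`, lane tail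
T-KOLY); ALSO the unit's GEN 10 beyond-window DATA record in `X11b/BeyondWindowRecords40.lean` (Skinner 2016 Thm. A ∘ Stein–Wuthrich 2013 `p`-adic
road, binders as displayed there) — this row is a SECOND road). `D = -1391` (1391 = 13·107): **`m = [E(K):ℤy_K] = 160`, `7 ∤ m`** (`ρ = 6399.99…`;
`L'(E,1) = 2.92590163…`, `L(E^D,1) = 0.19306412…`, `ĥ(x) = 2.94724821…`) — engine 1 (j259809) = engine 2 (j260660; EQUAL, dev. ≤ 1.1·10⁻¹³, checks
true); twist `E^D` (j260667): `#tors·∏c·#Ш_an = 1·40·16`, prime to `7` — BSD-consistent. Witnesses mod `7` `(ℓ,#Ẽ(𝔽_ℓ))` = `(19,19)` (`a = 1`,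
`a² − 4ℓ ≡ 2` square), `(13,17)` (`a = -3`, `a² − 4ℓ ≡ 6` non-square), `(13,17)` (`u ≡ 5`).
[cite: McCallumLMS1991, §1 Theorem (Kolyvagin), p. 296] [cite: Serre1972, §2.8 Prop. 19] [cite: Cremona2006, Table 1 (label 322770c1)] -/
theorem bsdp_k322770c1_7 (hGZK : rank_eq_analyticRank_of_analyticRank_le_one) (W : WeierstrassCurve ℚ)
    (hW : W = ⟨1, 1, 0, -2025992853, 35127984808557⟩) {N : ℕ} [NeZero N] {K : Type} [Field K] [NumberField K]
    (hKo : kolyvagin N W K) (hB : Kolyvagin1990_padicValNat_card_sha_le N W K) (hK : IsImaginaryQuadratic K)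
    (hH : SatisfiesHeegnerHypothesis N K) {P : (W.baseChange K).toAffine.Point} (hP : IsHeegnerPoint N W K P)
    (hnt : ¬ IsOfFinAddOrder P) (hI : ¬ 7 ∣ (AddSubgroup.zmultiples P).index) (hr : W.analyticRank ≤ 1)
    {q : ℚ} (hq : shaAn W = (q : ℂ)) (hv : padicValRat 7 q = 0) : BSDp W 7 :=
  bsdp_prime_of_kolyvaginIndex_of_serreCounts 7 (by norm_num) (by norm_num) 1 1 0 (-2025992853) 35127984808557 (by decide +kernel)
    (by decide +kernel) (by decide +kernel) 19 13 13 (by norm_num) (by norm_num) (by norm_num) (by norm_num)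
    (by norm_num) (by norm_num) (by norm_num) (by norm_num) (by norm_num) (by decide +kernel) (by decide +kernel)
    (by decide +kernel) (n₁ := 19) (n₂ := 17) (n₃ := 17) (hc₁ := by decide +kernel) (hc₂ := by decide +kernel)
    (hc₃ := by decide +kernel) (by decide +kernel) (by decide +kernel) (by decide +kernel) hGZK W
    (by rw [hW]; norm_num) hKo hB hK hH hP hnt hI hr hq hv

/-- **`BSD(E,7)` for `323610a1`** (`N = 323610 = 2·3·5·7·23·67`; NON-SPLIT MULTIPLICATIVE at `7` (Kodaira `I1`, `c_7 = 1`, semistable); `#tors = 1`,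
`∏c = 1`, `r_an = 1`, `#Ш_an = 1`, generator `(-3, 31)`; lane residue cell `(7, X11b)` (bsdN v4u/v5u of record: `residue:X11b`, lane tail T-KOLY);
ALSO the unit's GEN 10 beyond-window DATA record in `X11b/BeyondWindowRecords40.lean` (Skinner 2016 Thm. A ∘ Stein–Wuthrich 2013 `p`-adic road,
binders as displayed there) — this row is a SECOND road). `D = -3671` (3671 prime): **`m = [E(K):ℤy_K] = 10`, `7 ∤ m`** (`ρ = 25.00…`;
`L'(E,1) = 4.42336556…`, `L(E^D,1) = 0.56916248…`, `ĥ(x) = 2.70259769…`) — engine 1 (j259809) = engine 2 (j260660; EQUAL, dev. ≤ 2.6·10⁻¹³, checks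
true); twist `E^D` (j260667): `#tors·∏c·#Ш_an = 1·1·25`, prime to `7` — BSD-consistent. Witnesses mod `7` `(ℓ,#Ẽ(𝔽_ℓ))` = `(13,9)` (`a = 5`,
`a² − 4ℓ ≡ 1` square), `(31,37)` (`a = -5`, `a² − 4ℓ ≡ 6` non-square), `(13,9)` (`u ≡ 3`).
[cite: McCallumLMS1991, §1 Theorem (Kolyvagin), p. 296] [cite: Serre1972, §2.8 Prop. 19] [cite: Cremona2006, Table 1 (label 323610a1)] -/
theorem bsdp_k323610a1_7 (hGZK : rank_eq_analyticRank_of_analyticRank_le_one) (W : WeierstrassCurve ℚ)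
    (hW : W = ⟨1, 1, 0, -163, 397⟩) {N : ℕ} [NeZero N] {K : Type} [Field K] [NumberField K]
    (hKo : kolyvagin N W K) (hB : Kolyvagin1990_padicValNat_card_sha_le N W K) (hK : IsImaginaryQuadratic K)
    (hH : SatisfiesHeegnerHypothesis N K) {P : (W.baseChange K).toAffine.Point} (hP : IsHeegnerPoint N W K P)
    (hnt : ¬ IsOfFinAddOrder P) (hI : ¬ 7 ∣ (AddSubgroup.zmultiples P).index) (hr : W.analyticRank ≤ 1)
    {q : ℚ} (hq : shaAn W = (q : ℂ)) (hv : padicValRat 7 q = 0) : BSDp W 7 :=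
  bsdp_prime_of_kolyvaginIndex_of_serreCounts 7 (by norm_num) (by norm_num) 1 1 0 (-163) 397 (by decide +kernel)
    (by decide +kernel) (by decide +kernel) 13 31 13 (by norm_num) (by norm_num) (by norm_num) (by norm_num)
    (by norm_num) (by norm_num) (by norm_num) (by norm_num) (by norm_num) (by decide +kernel) (by decide +kernel)
    (by decide +kernel) (n₁ := 9) (n₂ := 37) (n₃ := 9) (hc₁ := by decide +kernel) (hc₂ := by decide +kernel)
    (hc₃ := by decide +kernel) (by decide +kernel) (by decide +kernel) (by decide +kernel) hGZK W
    (by rw [hW]; norm_num) hKo hB hK hH hP hnt hI hr hq hv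

/-- **`BSD(E,7)` for `325710bt1`** (`N = 325710 = 2·3²·5·7·11·47`; NON-SPLIT MULTIPLICATIVE at `7` (Kodaira `I3`, `c_7 = 1`, additive at `3`);
`#tors = 2`, `∏c = 16`, `r_an = 1`, `#Ш_an = 1`, generator `(-110, 38615)`; lane residue cell `(7, X11b)` (bsdN v4u/v5u of record: `residue:X11b`,
lane tail T-KOLY); ALSO the unit's GEN 10 beyond-window DATA record in `X11b/BeyondWindowRecords40.lean` (Skinner 2016 Thm. A ∘ Stein–Wuthrich 2013
`p`-adic road, binders as displayed there) — this row is a SECOND road). `D = -3671` (3671 prime): **`m = [E(K):ℤy_K] = 32`, `7 ∤ m`**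
(`ρ = 255.99…`; `L'(E,1) = 4.89477284…`, `L(E^D,1) = 0.13104638…`, `ĥ(x) = 5.17537221…`) — engine 1 (j259809) = engine 2 (j260660; EQUAL, dev. ≤
6.6·10⁻¹⁴, checks true); twist `E^D` (j260667): `#tors·∏c·#Ш_an = 2·64·4`, prime to `7` — BSD-consistent. Witnesses mod `7` `(ℓ,#Ẽ(𝔽_ℓ))` =
`(31,42)` (`a = -10`, `a² − 4ℓ ≡ 4` square), `(13,18)` (`a = -4`, `a² − 4ℓ ≡ 6` non-square), `(13,18)` (`u ≡ 5`).
[cite: McCallumLMS1991, §1 Theorem (Kolyvagin), p. 296] [cite: Serre1972, §2.8 Prop. 19] [cite: Cremona2006, Table 1 (label 325710bt1)] -/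
theorem bsdp_k325710bt1_7 (hGZK : rank_eq_analyticRank_of_analyticRank_le_one) (W : WeierstrassCurve ℚ)
    (hW : W = ⟨1, -1, 0, -2196369, 1246613085⟩) {N : ℕ} [NeZero N] {K : Type} [Field K] [NumberField K]
    (hKo : kolyvagin N W K) (hB : Kolyvagin1990_padicValNat_card_sha_le N W K) (hK : IsImaginaryQuadratic K)
    (hH : SatisfiesHeegnerHypothesis N K) {P : (W.baseChange K).toAffine.Point} (hP : IsHeegnerPoint N W K P)
    (hnt : ¬ IsOfFinAddOrder P) (hI : ¬ 7 ∣ (AddSubgroup.zmultiples P).index) (hr : W.analyticRank ≤ 1)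
    {q : ℚ} (hq : shaAn W = (q : ℂ)) (hv : padicValRat 7 q = 0) : BSDp W 7 :=
  bsdp_prime_of_kolyvaginIndex_of_serreCounts 7 (by norm_num) (by norm_num) 1 (-1) 0 (-2196369) 1246613085 (by decide +kernel)
    (by decide +kernel) (by decide +kernel) 31 13 13 (by norm_num) (by norm_num) (by norm_num) (by norm_num)
    (by norm_num) (by norm_num) (by norm_num) (by norm_num) (by norm_num) (by decide +kernel) (by decide +kernel)
    (by decide +kernel) (n₁ := 42) (n₂ := 18) (n₃ := 18) (hc₁ := by decide +kernel) (hc₂ := by decide +kernel)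
    (hc₃ := by decide +kernel) (by decide +kernel) (by decide +kernel) (by decide +kernel) hGZK W
    (by rw [hW]; norm_num) hKo hB hK hH hP hnt hI hr hq hv

end Summit.BirchSwinnertonDyer.Rank1Residual.X11b

end
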